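import Literature.RepresentationTheory.CompactGroups.WeylIntegrationUnitary
import Literature.LinearAlgebra.Matrix.SpecialUnitaryGroupConjugacyClasses
import Mathlib.MeasureTheory.Function.SpecialFunctions.Basic

/-!
# Weyl's integral formula for `SU(n)`, from the `U(n)` formula: the measurable special part `u ↦ ζ(u)⁻¹u`
# (`ζ(u) = e^{i arg(det u)/n}`) pushes Haar of `U(n)` to Haar of `SU(n)` and Haar of `Δ(n)` to Haar of `SΔ(n)`

statement-level skeleton of published theorems with citation tags; proofs where landed; nothing here is a claim
about the Yang–Mills mass gap

Mega-formalization `lit-balaban` (HOME `run/shared/lean/pub/lit-balaban/`), unit `lit-balaban-p28` gen 15 (Phase-2 proof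
seat, free-target protocol G.5-34(d)): discharge of the tree's SECOND named fact
`Literature.RepresentationTheory.CompactGroups.weylIntegralFormula_specialUnitary` ([BtD] IV (1.11) for `G = SU(n)`,
`T = SΔ(n)` (IV (3.1)), `W = S(n)` (IV (3.3)), pushforward form) FROM the `U(n)` case (files 1–9):
* §1 THE SPECIAL PART `specialPart u = ζ(u)⁻¹ u ∈ SU(n)`, `ζ(u) = e^{i arg(det u)/n}` — a MEASURABLE (not continuous)
  map `U(n) → SU(n)` which is `SU(n)`-equivariant on both sides and compatible with conjugation; it maps `Δ(n)` to
  `SΔ(n)`, and the Weyl weight `Π_iΠ_{j≠i}|t_ii − t_jj|/n!` is unchanged by it (`|ζ| = 1`);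
* §2 by uniqueness of Haar measure (`Measure.haarMeasure_unique`) the special part pushes the Haar probability of
  `U(n)` to that of `SU(n)` and the Haar probability of `Δ(n)` to that of `SΔ(n)`;
* §3 **`lintegral_haarProbability_specialUnitaryGroup_eq_lintegral_specialDiagonalTorus`**: the class-function Weyl
  formula for `SU(n)` — `∫_{SU(n)} F = ∫_{SΔ(n)} (Π_iΠ_{j≠i}|t_ii − t_jj|/n!) F(t) dt` — from file 8 applied to the
  `U(n)`-class function `F ∘ specialPart`;
* §4 **`map_conj_haarProbability_prod_withDensity_eq_su`**: the pushforward form, LITERALLY the body of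
  `weylIntegralFormula_specialUnitary` (conjugation mass on `SU(n)`, as for `U(n)` in file 9).

0 named facts, 0 sorry.

## References
* Th. Bröcker, T. tom Dieck, *Representations of Compact Lie Groups*, GTM 98 (1985), Ch. IV (1.11) p. 163, (3.1), (3.3)
  pp. 170–171 (held: `book:brockernd-representations-compact-lie-groups`, p0153, p0160–p0161). [BrockerTomDieck1985]
-/

noncomputable section

open Complex Matrix MeasureTheory Set
open scoped ComplexConjugate ENNReal Matrix.Norms.L2Operator

namespace Literature.RepresentationTheory.CompactGroups.WeylIntegration

open Literature.MathematicalPhysics.QuantumFieldTheory (haarProbability measurePreserving_conj)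
open Literature.LinearAlgebra.Matrix (diagonalTorus specialDiagonalTorus)

variable {n : Type*} [Fintype n] [DecidableEq n]

/-! ## §1 The special part of a unitary matrix -/

/-- THE DETERMINANT PHASE `ζ(u) = e^{i·arg(det u)/n}` (an `n`-th root of `det u` for unitary `u`).
[cite: BrockerTomDieck1985, IV (3.1) p0160] -/
def detPhase (u : Matrix n n ℂ) : ℂ := cexp (((Complex.arg u.det / Fintype.card n : ℝ) : ℂ) * I)

omit [DecidableEq n] in
/-- `|ζ(u)| = 1`. [cite: BrockerTomDieck1985, IV (3.1) p0160] -/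
theorem norm_detPhase [DecidableEq n] (u : Matrix n n ℂ) : ‖detPhase u‖ = 1 := by
  rw [detPhase, Complex.norm_exp_ofReal_mul_I]

/-- `ζ(u) · conj ζ(u) = 1`. [cite: BrockerTomDieck1985, IV (3.1) p0160] -/
theorem detPhase_mul_conj (u : Matrix n n ℂ) : detPhase u * conj (detPhase u) = 1 := by
  rw [Complex.mul_conj', norm_detPhase, Complex.ofReal_one, one_pow]

/-- `ζ(u) ≠ 0`. [cite: BrockerTomDieck1985, IV (3.1) p0160] -/
theorem detPhase_ne_zero (u : Matrix n n ℂ) : detPhase u ≠ 0 :=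
  norm_ne_zero_iff.1 (by rw [norm_detPhase]; exact one_ne_zero)

/-- `|det u| = 1` for unitary `u`. [cite: BrockerTomDieck1985, IV (3.1) p0160] -/
theorem norm_det_eq_one {u : Matrix n n ℂ} (hu : u ∈ Matrix.unitaryGroup n ℂ) : ‖u.det‖ = 1 := by
  have h := (Unitary.mem_iff.mp (Matrix.det_of_mem_unitary hu)).1
  rw [Complex.star_def, Complex.conj_mul', ← Complex.ofReal_pow, ← Complex.ofReal_one, Complex.ofReal_inj] at h
  exact (pow_eq_one_iff_of_nonneg (norm_nonneg _) two_ne_zero).mp h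

/-- `ζ(u)ⁿ = det u` for unitary `u`. [cite: BrockerTomDieck1985, IV (3.1) p0160] -/
theorem detPhase_pow {u : Matrix n n ℂ} (hu : u ∈ Matrix.unitaryGroup n ℂ) : detPhase u ^ Fintype.card n = u.det := by
  rcases isEmpty_or_nonempty n with hn | hn
  · rw [Fintype.card_eq_zero, pow_zero, Matrix.det_isEmpty]
  · rw [detPhase, ← Complex.exp_nat_mul]
    have hN : (Fintype.card n : ℂ) ≠ 0 := Nat.cast_ne_zero.2 Fintype.card_ne_zero
    rw [show (Fintype.card n : ℂ) * (((Complex.arg u.det / Fintype.card n : ℝ) : ℂ) * I) = Complex.arg u.det * I by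
      push_cast; field_simp]
    have h := Complex.norm_mul_exp_arg_mul_I u.det
    rw [norm_det_eq_one hu, Complex.ofReal_one, one_mul] at h
    exact h

/-- `ζ(u)⁻¹ u ∈ SU(n)` for `u ∈ U(n)`. [cite: BrockerTomDieck1985, IV (3.1) p0160] -/
theorem inv_detPhase_smul_mem {u : Matrix n n ℂ} (hu : u ∈ Matrix.unitaryGroup n ℂ) :
    (detPhase u)⁻¹ • u ∈ Matrix.specialUnitaryGroup n ℂ := by
  have hcc : (detPhase u)⁻¹ * star (detPhase u)⁻¹ = 1 := by
    rw [Complex.star_def, Complex.mul_conj', norm_inv, norm_detPhase, inv_one, Complex.ofReal_one, one_pow]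
  refine Matrix.mem_specialUnitaryGroup_iff.mpr ⟨?_, ?_⟩
  · rw [Matrix.mem_unitaryGroup_iff, star_eq_conjTranspose, conjTranspose_smul, smul_mul_assoc, mul_smul_comm,
      smul_smul, hcc, one_smul, ← star_eq_conjTranspose]
    exact Matrix.mem_unitaryGroup_iff.mp hu
  · rw [det_smul, ← detPhase_pow hu, inv_pow, inv_mul_cancel₀ (pow_ne_zero _ (detPhase_ne_zero u))]

/-- THE SPECIAL PART `specialPart u = ζ(u)⁻¹ u ∈ SU(n)` of `u ∈ U(n)`. [cite: BrockerTomDieck1985, IV (3.1) p0160] -/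
def specialPart (u : Matrix.unitaryGroup n ℂ) : Matrix.specialUnitaryGroup n ℂ :=
  ⟨(detPhase (u : Matrix n n ℂ))⁻¹ • (u : Matrix n n ℂ), inv_detPhase_smul_mem u.2⟩

/-- [cite: BrockerTomDieck1985, IV (3.1) p0160] -/
@[simp] theorem coe_specialPart (u : Matrix.unitaryGroup n ℂ) :
    ((specialPart u : Matrix.specialUnitaryGroup n ℂ) : Matrix n n ℂ) = (detPhase (u : Matrix n n ℂ))⁻¹ • (u : Matrix n n ℂ) :=
  rfl

/-- `ζ` is unchanged by multiplication with an element of `SU(n)` (`det` is). [cite: BrockerTomDieck1985, IV (3.1) p0160] -/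
theorem detPhase_mul_su (u : Matrix n n ℂ) (V : Matrix.specialUnitaryGroup n ℂ) :
    detPhase (u * (V : Matrix n n ℂ)) = detPhase u ∧ detPhase ((V : Matrix n n ℂ) * u) = detPhase u := by
  have hV : (V : Matrix n n ℂ).det = 1 := (Matrix.mem_specialUnitaryGroup_iff.1 V.2).2
  constructor <;> simp only [detPhase, Matrix.det_mul, hV, mul_one, one_mul]

/-- `u = ζ(u) · specialPart u` as matrices. [cite: BrockerTomDieck1985, IV (3.1) p0160] -/
theorem coe_eq_detPhase_smul (u : Matrix.unitaryGroup n ℂ) :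
    (u : Matrix n n ℂ) = detPhase (u : Matrix n n ℂ) • ((specialPart u : Matrix.specialUnitaryGroup n ℂ) : Matrix n n ℂ) := by
  rw [coe_specialPart, smul_smul, mul_inv_cancel₀ (detPhase_ne_zero _), one_smul]

/-- `specialPart` is measurable (`arg` is measurable; the Borel σ-algebra of `SU(n)` is the trace of the ambient one).
[cite: BrockerTomDieck1985, IV (3.1) p0160] -/
theorem measurable_specialPart : Measurable (specialPart (n := n)) := by
  letI : MeasurableSpace (Matrix n n ℂ) := borel _
  haveI : BorelSpace (Matrix n n ℂ) := ⟨rfl⟩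
  have hcoe : Continuous fun u : Matrix.unitaryGroup n ℂ => (u : Matrix n n ℂ) := continuous_subtype_val
  have hdet : Measurable fun u : Matrix.unitaryGroup n ℂ => (u : Matrix n n ℂ).det :=
    (Continuous.matrix_det hcoe).measurable
  have hζ : Measurable fun u : Matrix.unitaryGroup n ℂ => detPhase (u : Matrix n n ℂ) := by
    unfold detPhase
    exact Complex.continuous_exp.measurable.comp
      ((Complex.measurable_ofReal.comp ((Complex.measurable_arg.comp hdet).div_const _)).mul_const _)
  have h1 : Measurable fun u : Matrix.unitaryGroup n ℂ => ((detPhase (u : Matrix n n ℂ))⁻¹, (u : Matrix n n ℂ)) :=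
    hζ.inv.prodMk hcoe.measurable
  have hM : Measurable fun u : Matrix.unitaryGroup n ℂ => (detPhase (u : Matrix n n ℂ))⁻¹ • (u : Matrix n n ℂ) :=
    (continuous_fst.smul continuous_snd).measurable.comp h1
  -- measurability into the subtype σ-algebra, which coincides with the (registered) Borel σ-algebra of `SU(n)`
  have key : @Measurable _ _ _ Subtype.instMeasurableSpace (specialPart (n := n)) := hM.subtype_mk
  have hinst : (Matrix.specialUnitaryGroup.instMeasurableSpace : MeasurableSpace (Matrix.specialUnitaryGroup n ℂ)) =
      Subtype.instMeasurableSpace := borel_comap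
  exact key.mono le_rfl hinst.le

open Literature.LinearAlgebra.Matrix (suToUnitary coe_suToUnitary)

/-- **Left equivariance**: `specialPart(V u) = V · specialPart(u)` for `V ∈ SU(n)`. [cite: BrockerTomDieck1985, IV (3.1) p0160] -/
theorem specialPart_su_mul (V : Matrix.specialUnitaryGroup n ℂ) (u : Matrix.unitaryGroup n ℂ) :
    specialPart (suToUnitary n V * u) = V * specialPart u := by
  apply Subtype.ext
  change (detPhase ((V : Matrix n n ℂ) * (u : Matrix n n ℂ)))⁻¹ • ((V : Matrix n n ℂ) * (u : Matrix n n ℂ)) =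
    (V : Matrix n n ℂ) * ((detPhase (u : Matrix n n ℂ))⁻¹ • (u : Matrix n n ℂ))
  rw [(detPhase_mul_su _ V).2, Matrix.mul_smul]

/-- **Right equivariance**: `specialPart(u V) = specialPart(u) · V` for `V ∈ SU(n)`. [cite: BrockerTomDieck1985, IV (3.1) p0160] -/
theorem specialPart_mul_su (u : Matrix.unitaryGroup n ℂ) (V : Matrix.specialUnitaryGroup n ℂ) :
    specialPart (u * suToUnitary n V) = specialPart u * V := by
  apply Subtype.ext
  change (detPhase ((u : Matrix n n ℂ) * (V : Matrix n n ℂ)))⁻¹ • ((u : Matrix n n ℂ) * (V : Matrix n n ℂ)) =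
    ((detPhase (u : Matrix n n ℂ))⁻¹ • (u : Matrix n n ℂ)) * (V : Matrix n n ℂ)
  rw [(detPhase_mul_su _ V).1, Matrix.smul_mul]

/-- Conjugation by `g ∈ U(n)` is conjugation by its special part (the phase is central).
[cite: BrockerTomDieck1985, IV (3.1) p0160] -/
theorem conj_eq_conj_specialPart (g u : Matrix.unitaryGroup n ℂ) :
    g * u * g⁻¹ = suToUnitary n (specialPart g) * u * (suToUnitary n (specialPart g))⁻¹ := by
  apply Subtype.ext
  rw [Matrix.UnitaryGroup.mul_val, Matrix.UnitaryGroup.mul_val, Matrix.UnitaryGroup.inv_val,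
    Matrix.UnitaryGroup.mul_val, Matrix.UnitaryGroup.mul_val, Matrix.UnitaryGroup.inv_val]
  change (g : Matrix n n ℂ) * (u : Matrix n n ℂ) * star (g : Matrix n n ℂ) =
    ((specialPart g : Matrix.specialUnitaryGroup n ℂ) : Matrix n n ℂ) * (u : Matrix n n ℂ) *
      star ((specialPart g : Matrix.specialUnitaryGroup n ℂ) : Matrix n n ℂ)
  conv_lhs => rw [coe_eq_detPhase_smul g]
  rw [star_smul, Matrix.smul_mul, Matrix.smul_mul, Matrix.mul_smul, smul_smul, Complex.star_def, detPhase_mul_conj,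
    one_smul]

/-- **Conjugation**: `specialPart(g u g⁻¹) = specialPart(g) · specialPart(u) · specialPart(g)⁻¹`.
[cite: BrockerTomDieck1985, IV (3.1) p0160] -/
theorem specialPart_conj (g u : Matrix.unitaryGroup n ℂ) :
    specialPart (g * u * g⁻¹) = specialPart g * specialPart u * (specialPart g)⁻¹ := by
  rw [conj_eq_conj_specialPart, ← map_inv, specialPart_mul_su, specialPart_su_mul]

/-! ## §2 The special part pushes Haar of `U(n)` to Haar of `SU(n)`, and Haar of `Δ(n)` to Haar of `SΔ(n)` -/

/-- A left-invariant probability measure on a compact (second countable) group is its Haar probability measure.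
[cite: BrockerTomDieck1985, I (5.13) p0045] -/
theorem eq_haarProbability_of_isMulLeftInvariant {H : Type*} [Group H] [TopologicalSpace H] [IsTopologicalGroup H]
    [CompactSpace H] [MeasurableSpace H] [BorelSpace H] [SecondCountableTopology H] (ν : Measure H)
    [IsProbabilityMeasure ν] [ν.IsMulLeftInvariant] : ν = haarProbability H := by
  rw [Measure.haarMeasure_unique ν ⊤, TopologicalSpace.PositiveCompacts.coe_top, measure_univ, one_smul]
  rfl

/-- **`specialPart_* Haar_{U(n)} = Haar_{SU(n)}`** (left `SU(n)`-equivariance + uniqueness of Haar measure).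
[cite: BrockerTomDieck1985, I (5.13) p0045] [cite: BrockerTomDieck1985, IV (3.1) p0160] -/
theorem map_specialPart_haarProbability :
    Measure.map specialPart (haarProbability (Matrix.unitaryGroup n ℂ)) = haarProbability (Matrix.specialUnitaryGroup n ℂ) := by
  haveI : SecondCountableTopology (Matrix.specialUnitaryGroup n ℂ) := TopologicalSpace.Subtype.secondCountableTopology _
  haveI : IsProbabilityMeasure (Measure.map specialPart (haarProbability (Matrix.unitaryGroup n ℂ))) :=
    Measure.isProbabilityMeasure_map measurable_specialPart.aemeasurable
  haveI : (Measure.map specialPart (haarProbability (Matrix.unitaryGroup n ℂ))).IsMulLeftInvariant := by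
    refine ⟨fun V => ?_⟩
    rw [Measure.map_map (measurable_const_mul V) measurable_specialPart]
    have hcomp : (fun x => V * x) ∘ specialPart = specialPart ∘ fun u : Matrix.unitaryGroup n ℂ => suToUnitary n V * u := by
      funext u; simp only [Function.comp_apply, specialPart_su_mul]
    rw [hcomp, ← Measure.map_map measurable_specialPart (measurable_const_mul _), map_mul_left_eq_self]
  exact eq_haarProbability_of_isMulLeftInvariant _

/-- THE SPECIAL PART ON THE TORI: `Δ(n) → SΔ(n)`. [cite: BrockerTomDieck1985, IV (3.1) p0160] -/
def specialPartT (t : diagonalTorus n) : specialDiagonalTorus n :=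
  ⟨specialPart (t : Matrix.unitaryGroup n ℂ), by
    obtain ⟨d, hd⟩ := t.2
    refine ⟨(detPhase ((t : Matrix.unitaryGroup n ℂ) : Matrix n n ℂ))⁻¹ • d, ?_⟩
    rw [coe_specialPart, hd, diagonal_smul]⟩

/-- [cite: BrockerTomDieck1985, IV (3.1) p0160] -/
@[simp] theorem coe_specialPartT (t : diagonalTorus n) :
    ((specialPartT t : specialDiagonalTorus n) : Matrix.specialUnitaryGroup n ℂ) = specialPart (t : Matrix.unitaryGroup n ℂ) :=
  rfl

/-- `specialPartT` is measurable. [cite: BrockerTomDieck1985, IV (3.1) p0160] -/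
theorem measurable_specialPartT : Measurable (specialPartT (n := n)) :=
  (measurable_specialPart.comp measurable_subtype_coe).subtype_mk

/-- The inclusion `SΔ(n) → Δ(n)`. [cite: BrockerTomDieck1985, IV (3.1) p0160] -/
def torusIncl (s : specialDiagonalTorus n) : diagonalTorus n :=
  ⟨suToUnitary n (s : Matrix.specialUnitaryGroup n ℂ), by obtain ⟨d, hd⟩ := s.2; exact ⟨d, hd⟩⟩

/-- Left `SΔ(n)`-equivariance of `specialPartT`. [cite: BrockerTomDieck1985, IV (3.1) p0160] -/
theorem specialPartT_mul (s : specialDiagonalTorus n) (t : diagonalTorus n) :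
    specialPartT (torusIncl s * t) = s * specialPartT t := by
  apply Subtype.ext
  exact specialPart_su_mul (s : Matrix.specialUnitaryGroup n ℂ) (t : Matrix.unitaryGroup n ℂ)

/-- **`specialPartT_* Haar_{Δ(n)} = Haar_{SΔ(n)}`**. [cite: BrockerTomDieck1985, I (5.13) p0045] [cite: BrockerTomDieck1985, IV (3.1) p0160] -/
theorem map_specialPartT_haarProbability :
    Measure.map specialPartT (haarProbability (diagonalTorus n)) = haarProbability (specialDiagonalTorus n) := by
  haveI : SecondCountableTopology (specialDiagonalTorus n) := TopologicalSpace.Subtype.secondCountableTopology _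
  haveI : IsProbabilityMeasure (Measure.map specialPartT (haarProbability (diagonalTorus n))) :=
    Measure.isProbabilityMeasure_map measurable_specialPartT.aemeasurable
  haveI : (Measure.map specialPartT (haarProbability (diagonalTorus n))).IsMulLeftInvariant := by
    refine ⟨fun s => ?_⟩
    rw [Measure.map_map (measurable_const_mul s) measurable_specialPartT]
    have hcomp : (fun x => s * x) ∘ specialPartT = specialPartT ∘ fun t : diagonalTorus n => torusIncl s * t := by
      funext t; simp only [Function.comp_apply, specialPartT_mul]
    rw [hcomp, ← Measure.map_map measurable_specialPartT (measurable_const_mul _), map_mul_left_eq_self]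
  exact eq_haarProbability_of_isMulLeftInvariant _

/-! ## §3 The class-function Weyl formula for `SU(n)` -/

/-- THE WEYL WEIGHT on `SΔ(n)`: `w(t) = Π_i Π_{j≠i}|t_ii − t_jj| / n!`, exactly as in the tree's fact
`weylIntegralFormula_specialUnitary`. [cite: BrockerTomDieck1985, IV (1.11) p0153] -/
def weylWeightSU (t : specialDiagonalTorus n) : ℝ≥0∞ :=
  ENNReal.ofReal ((∏ i, ∏ j ∈ Finset.univ.erase i,
    ‖((t : Matrix.specialUnitaryGroup n ℂ) : Matrix n n ℂ) i i - ((t : Matrix.specialUnitaryGroup n ℂ) : Matrix n n ℂ) j j‖) /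
      (Fintype.card n).factorial)

/-- `w` is measurable on `SΔ(n)`. [cite: BrockerTomDieck1985, IV (1.11) p0153] -/
theorem measurable_weylWeightSU : Measurable (weylWeightSU (n := n)) := by
  have hc : Continuous fun t : specialDiagonalTorus n => ((t : Matrix.specialUnitaryGroup n ℂ) : Matrix n n ℂ) :=
    continuous_subtype_val.comp continuous_subtype_val
  refine ENNReal.measurable_ofReal.comp (Continuous.div_const ?_ _).measurable
  refine continuous_finsetProd _ fun i _ => continuous_finsetProd _ fun j _ => ?_
  exact ((hc.matrix_elem i i).sub (hc.matrix_elem j j)).norm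

/-- The weight is unchanged by the special part (`|ζ| = 1`): `w_{SΔ}(specialPartT t) = w_Δ(t)`.
[cite: BrockerTomDieck1985, IV (1.11) p0153] -/
theorem weylWeightSU_specialPartT (t : diagonalTorus n) : weylWeightSU (specialPartT t) = weylWeight t := by
  unfold weylWeightSU weylWeight
  congr 2
  refine Finset.prod_congr rfl fun i _ => Finset.prod_congr rfl fun j _ => ?_
  rw [coe_specialPartT, coe_specialPart, Matrix.smul_apply, Matrix.smul_apply, ← smul_sub, norm_smul, norm_inv,
    norm_detPhase, inv_one, one_mul]

/-- **WEYL'S INTEGRAL FORMULA FOR `SU(n)`, CLASS-FUNCTION FORM**: for every measurable class function `F ≥ 0` on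
`SU(n)`, `∫_{SU(n)} F d(Haar prob.) = ∫_{SΔ(n)} (Π_iΠ_{j≠i}|t_ii − t_jj|/n!) F(t) d(Haar prob.)` — from the `U(n)`
formula (file 8) for the `U(n)`-class function `F ∘ specialPart` and §2. [cite: BrockerTomDieck1985, IV (1.11) p0153] -/
theorem lintegral_haarProbability_specialUnitaryGroup_eq_lintegral_specialDiagonalTorus
    {F : Matrix.specialUnitaryGroup n ℂ → ℝ≥0∞} (hF : Measurable F)
    (hcl : ∀ g u : Matrix.specialUnitaryGroup n ℂ, F (g * u * g⁻¹) = F u) :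
    ∫⁻ u, F u ∂haarProbability (Matrix.specialUnitaryGroup n ℂ) =
      ∫⁻ t, weylWeightSU t * F (t : Matrix.specialUnitaryGroup n ℂ) ∂haarProbability (specialDiagonalTorus n) := by
  rw [← map_specialPart_haarProbability, lintegral_map hF measurable_specialPart]
  have hcl' : ∀ g u : Matrix.unitaryGroup n ℂ, (F ∘ specialPart) (g * u * g⁻¹) = (F ∘ specialPart) u := fun g u => by
    simp only [Function.comp_apply, specialPart_conj, hcl]
  have hmeas : Measurable fun t : specialDiagonalTorus n => weylWeightSU t * F (t : Matrix.specialUnitaryGroup n ℂ) :=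
    measurable_weylWeightSU.mul (hF.comp measurable_subtype_coe)
  rw [show (fun u => F (specialPart u)) = F ∘ specialPart from rfl,
    lintegral_haarProbability_unitaryGroup_eq_lintegral_diagonalTorus (hF.comp measurable_specialPart) hcl',
    ← map_specialPartT_haarProbability, lintegral_map hmeas measurable_specialPartT]
  refine lintegral_congr fun t => ?_
  rw [weylWeightSU_specialPartT]
  rfl

/-! ## §4 The pushforward form -/

/-- THE CONJUGATION MASS on `SU(n)`: `κ_S(u) = Haar{g ∈ SU(n) : g u g⁻¹ ∈ S}`. [cite: BrockerTomDieck1985, IV (1.11) p0153] -/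
def conjMassSU (S : Set (Matrix.specialUnitaryGroup n ℂ)) (u : Matrix.specialUnitaryGroup n ℂ) : ℝ≥0∞ :=
  haarProbability (Matrix.specialUnitaryGroup n ℂ) ((fun g : Matrix.specialUnitaryGroup n ℂ => g * u * g⁻¹) ⁻¹' S)

/-- The conjugation relation on `SU(n)` is measurable. [cite: BrockerTomDieck1985, IV (1.11) p0153] -/
theorem measurableSet_conjRelSU {S : Set (Matrix.specialUnitaryGroup n ℂ)} (hS : MeasurableSet S) :
    MeasurableSet {p : Matrix.specialUnitaryGroup n ℂ × Matrix.specialUnitaryGroup n ℂ | p.1 * p.2 * p.1⁻¹ ∈ S} :=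
  hS.preimage ((continuous_fst.mul continuous_snd).mul continuous_fst.inv).measurable

/-- `κ_S` is measurable. [cite: BrockerTomDieck1985, IV (1.11) p0153] -/
theorem measurable_conjMassSU {S : Set (Matrix.specialUnitaryGroup n ℂ)} (hS : MeasurableSet S) :
    Measurable (conjMassSU S) := by
  have h := measurable_measure_prodMk_right (μ := haarProbability (Matrix.specialUnitaryGroup n ℂ))
    (measurableSet_conjRelSU hS)
  have hfun : conjMassSU S = fun u : Matrix.specialUnitaryGroup n ℂ => haarProbability (Matrix.specialUnitaryGroup n ℂ)
      ((fun g : Matrix.specialUnitaryGroup n ℂ => (g, u)) ⁻¹'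
        {p : Matrix.specialUnitaryGroup n ℂ × Matrix.specialUnitaryGroup n ℂ | p.1 * p.2 * p.1⁻¹ ∈ S}) := by
    funext u
    rfl
  rw [hfun]
  exact h

/-- `κ_S` is a class function on `SU(n)`. [cite: BrockerTomDieck1985, IV (1.11) p0153] [cite: BrockerTomDieck1985, I (5.11) p0044] -/
theorem conjMassSU_conj (S : Set (Matrix.specialUnitaryGroup n ℂ)) (h u : Matrix.specialUnitaryGroup n ℂ) :
    conjMassSU S (h * u * h⁻¹) = conjMassSU S u := by
  unfold conjMassSU
  have hset : (fun g : Matrix.specialUnitaryGroup n ℂ => g * (h * u * h⁻¹) * g⁻¹) ⁻¹' S =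
      (fun g : Matrix.specialUnitaryGroup n ℂ => g * h) ⁻¹'
        ((fun g : Matrix.specialUnitaryGroup n ℂ => g * u * g⁻¹) ⁻¹' S) := by
    ext g
    simp only [Set.mem_preimage, _root_.mul_inv_rev, mul_assoc]
  rw [hset, measure_preimage_mul_right]

/-- `∫_{SU(n)} κ_S = Haar(S)`. [cite: BrockerTomDieck1985, IV (1.11) p0153] [cite: BrockerTomDieck1985, I (5.11) p0044] -/
theorem lintegral_conjMassSU {S : Set (Matrix.specialUnitaryGroup n ℂ)} (hS : MeasurableSet S) :
    ∫⁻ u, conjMassSU S u ∂haarProbability (Matrix.specialUnitaryGroup n ℂ) =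
      haarProbability (Matrix.specialUnitaryGroup n ℂ) S := by
  set μ := haarProbability (Matrix.specialUnitaryGroup n ℂ) with hμ
  have hE := measurableSet_conjRelSU hS
  have h1 : (μ.prod μ) {p : Matrix.specialUnitaryGroup n ℂ × Matrix.specialUnitaryGroup n ℂ | p.1 * p.2 * p.1⁻¹ ∈ S} =
      ∫⁻ u, conjMassSU S u ∂μ := Measure.prod_apply_symm hE
  have h2 := Measure.prod_apply (μ := μ) (ν := μ) hE
  have h3 : ∀ g : Matrix.specialUnitaryGroup n ℂ,
      μ ((fun u : Matrix.specialUnitaryGroup n ℂ => (g, u)) ⁻¹'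
        {p : Matrix.specialUnitaryGroup n ℂ × Matrix.specialUnitaryGroup n ℂ | p.1 * p.2 * p.1⁻¹ ∈ S}) = μ S :=
    fun g => (measurePreserving_conj g).measure_preimage hS.nullMeasurableSet
  rw [← h1, h2]
  simp_rw [h3]
  rw [lintegral_const, measure_univ, mul_one]

/-- **WEYL'S INTEGRAL FORMULA FOR `SU(n)`, PUSHFORWARD FORM** (the body of the tree's named fact
`weylIntegralFormula_specialUnitary`): conjugation `(g, t) ↦ g t g⁻¹` maps
`Haar_{SU(n)} ⊗ (Π_iΠ_{j≠i}|t_ii − t_jj|/n!)·Haar_{SΔ(n)}` to `Haar_{SU(n)}`. [cite: BrockerTomDieck1985, IV (1.11) p0153] -/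
theorem map_conj_haarProbability_prod_withDensity_eq_su :
    Measure.map (fun q : Matrix.specialUnitaryGroup n ℂ × specialDiagonalTorus n =>
        q.1 * (q.2 : Matrix.specialUnitaryGroup n ℂ) * q.1⁻¹)
      ((haarProbability (Matrix.specialUnitaryGroup n ℂ)).prod
        ((haarProbability (specialDiagonalTorus n)).withDensity fun t => ENNReal.ofReal
          ((∏ i, ∏ j ∈ Finset.univ.erase i,
            ‖((t : Matrix.specialUnitaryGroup n ℂ) : Matrix n n ℂ) i i -
              ((t : Matrix.specialUnitaryGroup n ℂ) : Matrix n n ℂ) j j‖) / (Fintype.card n).factorial))) =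
      haarProbability (Matrix.specialUnitaryGroup n ℂ) := by
  have hw : (fun t : specialDiagonalTorus n => ENNReal.ofReal
      ((∏ i, ∏ j ∈ Finset.univ.erase i,
        ‖((t : Matrix.specialUnitaryGroup n ℂ) : Matrix n n ℂ) i i -
          ((t : Matrix.specialUnitaryGroup n ℂ) : Matrix n n ℂ) j j‖) / (Fintype.card n).factorial)) = weylWeightSU := rfl
  rw [hw]
  have hq : Measurable (fun q : Matrix.specialUnitaryGroup n ℂ × specialDiagonalTorus n =>
      q.1 * (q.2 : Matrix.specialUnitaryGroup n ℂ) * q.1⁻¹) :=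
    ((continuous_fst.mul (continuous_subtype_val.comp continuous_snd)).mul continuous_fst.inv).measurable
  ext S hS
  rw [Measure.map_apply hq hS, Measure.prod_apply_symm (hq hS)]
  have hin : ∀ t : specialDiagonalTorus n, haarProbability (Matrix.specialUnitaryGroup n ℂ)
      ((fun g : Matrix.specialUnitaryGroup n ℂ => (g, t)) ⁻¹'
        ((fun q : Matrix.specialUnitaryGroup n ℂ × specialDiagonalTorus n =>
          q.1 * (q.2 : Matrix.specialUnitaryGroup n ℂ) * q.1⁻¹) ⁻¹' S)) =
      conjMassSU S (t : Matrix.specialUnitaryGroup n ℂ) := fun t => rfl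
  simp_rw [hin]
  have hκ : Measurable fun t : specialDiagonalTorus n => conjMassSU S (t : Matrix.specialUnitaryGroup n ℂ) :=
    (measurable_conjMassSU hS).comp measurable_subtype_coe
  rw [lintegral_withDensity_eq_lintegral_mul _ measurable_weylWeightSU hκ]
  change ∫⁻ t, weylWeightSU t * conjMassSU S (t : Matrix.specialUnitaryGroup n ℂ) ∂haarProbability (specialDiagonalTorus n) = _
  rw [← lintegral_haarProbability_specialUnitaryGroup_eq_lintegral_specialDiagonalTorus (measurable_conjMassSU hS)
    (conjMassSU_conj S), lintegral_conjMassSU hS]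

end Literature.RepresentationTheory.CompactGroups.WeylIntegration
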